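import Mathlib
import Literature.NumberTheory.Transcendental.KZCalculus
import Summits.KontsevichZagierPeriods.KontsevichZagierPeriods.Theses.UnfoldedStokes

/-!
# `HyperellipticRiemannRelation` (stmt-KontsevichZagierPeriods-3522), line `SketchIdeator2`
# (locked-slab-simplex, reshaped by the lead: fibred half-plane transport) — SKELETON

Riemann's bilinear relation for the two first-kind forms `dx/y`, `x dx/y` of the genus-2 curve
`y² = P(x) = ∏_{i<5} (x − eᵢ)` (`e` strictly increasing, rational), interval form
`[J₁×J₂, g] − [J₁×J₄, g] + [J₃×J₄, g] ∈ KZ.relations`, `g(x₀,x₁) = (x₁ − x₀)/√(|P(x₀)||P(x₁)|)`.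

Chain. With `Φ(z) = ∏ⱼ √(z − eⱼ)` (principal roots; holomorphic on the upper half-plane `H`, boundary
phases `(−i,1,i,−1,−i,1)⁻¹` on the six gaps `J₀ = (−∞,e₀), J₁, …, J₄, J₅ = (e₄,∞)`), the ORDERED kernel
`K(x₀,x₁,s) = (x₁+is)/(Φ(x₀+is)Φ(x₁+is))` (form `dx/y` at the left point, `x dx/y` at the right
point, both at the SAME height `s`) satisfies the transport law `∂ₛK = i ∂_τ K` along the joint
translation `(x₀,x₁) = (τ−u, τ)`, `u > 0` a spectator.  ONE Newton–Leibniz move along the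
compactified height `σ = s/(1+s) ∈ [0,1]` (primitive `Im K`, zero at `σ = 1`) and ONE along the
compactified abscissa `τ` (primitive `Re K/(1−σ)²`, zero at `τ = ±∞`) show that the bottom face
`[{u>0}×ℝ, Im K(τ−u,τ,0)]` is a relation (`stub_engine`, an abstract two-move lemma, fed by the
analytic packages `stub_kernelCalculus`, `stub_kernelIntegrable`, `stub_bounds`).  Sheared back to
`{x₀ < x₁}` and cut along the gap grid, that face is the nine-term identity
`−P₀₁ + P₀₃ − P₀₅ + P₁₂ − P₁₄ − P₂₃ + P₂₅ + P₃₄ − P₄₅ ≡ 0`, `Pⱼₖ = [Jⱼ×Jₖ, x₁/√(|P(x₀)||P(x₁)|)]`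
(`stub_faces`, first conjunct; same-type boxes and diagonal triangles carry the zero integrand).
The same engine with the spectator `x₀ ∈ J_L` frozen at height `0` and the one-point kernel
`x₁ ↦ (x₁+is)/Φ(x₁+is)` gives the fibred linear relations `P_{L1} − P_{L3} + P_{L5} ≡ 0`
(`stub_faces`, second conjunct), and `(x₀,x₁) ↦ (x₁,x₀)` (rule 2) with `g = f − f∘swap`
(rule 1b) (`stub_swapGlue`) lands on the crux:
`crux = N′ + SL(0) − SL(2) + SL(4)` in the free abelian group.  Box representations exist by
`stub_boxReps`.  `HyperellipticRiemannRelation_of` composes the seven stubs and concludes the route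
declaration BY NAME.  No definitions are introduced: every object is written out, and the kernels
enter the stubs through defining hypotheses (`hΦ : ∀ z, Φ z = …`, `hV : ∀ w, V w = …`).

References: Kontsevich–Zagier 2001 §1.2 (rules 1–3); Farkas–Kra 1992 III.3.1 (3.1.1) (the value);
Griffiths–Harris 1978 Ch. 2 §2 (cut-surface proof, avoided here); Bochnak–Coste–Roy 1998 §2.2.
-/

noncomputable section

namespace Summit.KontsevichZagierPeriods.UnfoldedStokes.HyperellipticRiemannRelationLine

open Set MeasureTheory Filter Topology
open Literature.NumberTheory.Transcendental
open Literature.ModelTheory.ExponentialFields (IsSemialgebraic)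

/-! ## Stub 1 — the abstract two-move engine (rules 1, 2, 3; no analysis) -/

/-- **Fibred half-plane transport engine.** Coordinates `w = (a, τ, σ) ∈ ℝ³`: `a` a spectator
ranging in `A ⊆ ℝ`, `τ ∈ ℝ` the transport direction, `σ ∈ [0,1]` the (compactified) height.
Data: a base `D ⊆ A × ℝ` of full measure, a height-primitive `V` (semialgebraic on the closed band
`D × [0,1]`, continuous on each closed fibre, vanishing at `σ = 1`, with `∂_σ V = B` on the open
fibre), a bulk `B` (semialgebraic and absolutely integrable on the open prism `A × ℝ × (0,1)`) and an
abscissa-primitive `U` (semialgebraic on the open prism, `∂_τ U = B`, `U → 0` as `τ → ±∞`).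
Then the bottom face `[D, V(·,·,0)]` is a relation: Newton–Leibniz along `σ` (rule 3) turns it into
the bulk `[prism, B]` (null faces and the null set `(A×ℝ) \ D` by rule 1), which after the
coordinate permutation `(a,τ,σ) ↦ (a,σ,τ)` and the compactification `τ = (2ρ−1)/(ρ(1−ρ))` (rule 2)
is ONE Newton–Leibniz band along `ρ ∈ [0,1]` over `A × (0,1)` whose primitive `U` vanishes at both
ends (rule 3), i.e. a zero representation. [cite: KontsevichZagier2001, §1.2 rules (1)-(3)] -/
theorem stub_engine :
    ∀ (A : Set ℝ) (D : Set (Fin 2 → ℝ)) (V U B : (Fin 3 → ℝ) → ℝ),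
      IsSemialgebraic ℚ {t : Fin 1 → ℝ | t 0 ∈ A} →
      IsSemialgebraic ℚ D →
      D ⊆ {y : Fin 2 → ℝ | y 0 ∈ A} →
      volume ({y : Fin 2 → ℝ | y 0 ∈ A} \ D) = 0 →
      IsSemialgebraicFunOn ℚ
        {w : Fin 3 → ℝ | (![w 0, w 1] : Fin 2 → ℝ) ∈ D ∧ 0 ≤ w 2 ∧ w 2 ≤ 1} V →
      (∀ y ∈ D, ContinuousOn (fun σ : ℝ => V ![y 0, y 1, σ]) (Icc 0 1) ∧ V ![y 0, y 1, 1] = 0 ∧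
        ∀ σ ∈ Ioo (0:ℝ) 1, HasDerivAt (fun σ : ℝ => V ![y 0, y 1, σ]) (B ![y 0, y 1, σ]) σ) →
      IsSemialgebraicFunOn ℚ {w : Fin 3 → ℝ | w 0 ∈ A ∧ 0 < w 2 ∧ w 2 < 1} B →
      IsSemialgebraicFunOn ℚ {w : Fin 3 → ℝ | w 0 ∈ A ∧ 0 < w 2 ∧ w 2 < 1} U →
      IntegrableOn B {w : Fin 3 → ℝ | w 0 ∈ A ∧ 0 < w 2 ∧ w 2 < 1} →
      (∀ a ∈ A, ∀ σ ∈ Ioo (0:ℝ) 1,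
        (∀ τ : ℝ, HasDerivAt (fun τ : ℝ => U ![a, τ, σ]) (B ![a, τ, σ]) τ) ∧
        Tendsto (fun τ : ℝ => U ![a, τ, σ]) atTop (𝓝 0) ∧
        Tendsto (fun τ : ℝ => U ![a, τ, σ]) atBot (𝓝 0)) →
      ∀ F : KZ.IntegralRep 2, F.domain = D →
        EqOn F.integrand (fun y => V ![y 0, y 1, 0]) D →
        KZ.of F ∈ KZ.relations := by
  sorry

/-! ## Stub 2 — pointwise bounds for `1/Φ`, `z/Φ` and their derivatives on the closed upper
half-plane, and integrability of the dominating weights -/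

/-- **Kernel bounds.** For `z = x + is`, `s ≥ 0`, `x` off the branch points, with
`m(x) = (1 + Σₖ |x−eₖ|^{−3/4}) (1+x²)^{−5/8}` (integrable on `ℝ`):
`|1/Φ(z)| ≤ C m(x) (1+s²)^{−5/8}`, `|z/Φ(z)| ≤ C m(x) (1+s²)^{−1/8}`, and for `s > 0`
`|Φ(z)⁻¹ Σⱼ (z−eⱼ)⁻¹| ≤ C m(x) (1+s^{−3/4}) (1+s²)^{−9/8}`,
`|(1 − (z/2) Σⱼ (z−eⱼ)⁻¹)/Φ(z)| ≤ C m(x) (1+s^{−3/4}) (1+s²)^{−5/8}`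
(near a branch point `|z−eₖ|^{−3/2} ≤ (|x−eₖ| s)^{−3/4}`; far away `|z−eⱼ| ≥ |z|/2`); the two height
weights `(1+s^{−3/4})(1+s²)^{−5/8}`, `(1+s^{−3/4})(1+s²)^{−5/4}` are integrable on `(0,∞)`.
[folklore] -/
theorem stub_bounds :
    ∀ (e : Fin 5 → ℚ), StrictMono e →
    ∀ (Φ : ℂ → ℂ), (∀ z, Φ z = ∏ j : Fin 5, Complex.sqrt (z - ((e j : ℝ) : ℂ))) →
    ∀ (m : ℝ → ℝ), (∀ x, m x =
        (1 + ∑ k : Fin 5, |x - (e k : ℝ)| ^ (-(3:ℝ) / 4)) * (1 + x ^ 2) ^ (-(5:ℝ) / 8)) →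
      Integrable m ∧
      IntegrableOn (fun s : ℝ => (1 + s ^ (-(3:ℝ) / 4)) * (1 + s ^ 2) ^ (-(5:ℝ) / 8)) (Ioi 0) ∧
      IntegrableOn (fun s : ℝ => (1 + s ^ (-(3:ℝ) / 4)) * (1 + s ^ 2) ^ (-(5:ℝ) / 4)) (Ioi 0) ∧
      ∃ C : ℝ, 0 < C ∧ ∀ (x s : ℝ), 0 ≤ s → (∀ j, x ≠ (e j : ℝ)) →
        ‖(Φ ((x : ℂ) + (s : ℂ) * Complex.I))⁻¹‖ ≤ C * m x * (1 + s ^ 2) ^ (-(5:ℝ) / 8) ∧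
        ‖((x : ℂ) + (s : ℂ) * Complex.I) / Φ ((x : ℂ) + (s : ℂ) * Complex.I)‖ ≤
          C * m x * (1 + s ^ 2) ^ (-(1:ℝ) / 8) ∧
        (0 < s →
          ‖(Φ ((x : ℂ) + (s : ℂ) * Complex.I))⁻¹ *
              ∑ j : Fin 5, ((x : ℂ) + (s : ℂ) * Complex.I - ((e j : ℝ) : ℂ))⁻¹‖ ≤
            C * m x * (1 + s ^ (-(3:ℝ) / 4)) * (1 + s ^ 2) ^ (-(9:ℝ) / 8) ∧
          ‖(1 - ((x : ℂ) + (s : ℂ) * Complex.I) / 2 *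
                ∑ j : Fin 5, ((x : ℂ) + (s : ℂ) * Complex.I - ((e j : ℝ) : ℂ))⁻¹) /
              Φ ((x : ℂ) + (s : ℂ) * Complex.I)‖ ≤
            C * m x * (1 + s ^ (-(3:ℝ) / 4)) * (1 + s ^ 2) ^ (-(5:ℝ) / 8)) := by
  sorry

/-! ## Stub 3 — the two kernels satisfy the non-integrability hypotheses of the engine -/

/-- **Kernel calculus.** For the simplex kernel `K(x₀,x₁,s) = (x₁+is)/(Φ(x₀+is)Φ(x₁+is))` and its
`τ`-derivative `K′ = (1 − (z₁/2) Σⱼ ((z₀−eⱼ)⁻¹ + (z₁−eⱼ)⁻¹))/(Φ(z₀)Φ(z₁))` read in the coordinates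
`w = (u, τ, σ)`, `(x₀,x₁,s) = (τ−u, τ, σ/(1−σ))`: `V = Im K` (zero at `σ = 1`), `U = Re K/(1−σ)²`,
`B = Re K′/(1−σ)²` satisfy the engine hypotheses over `A = (0,∞)`, base
`D = {u > 0, τ ∉ E, τ−u ∉ E}` (Cauchy–Riemann: `∂ₛK = iK′`, `∂_τK = K′`; `√·` is continuous from
above on the cut, so `V` is continuous at `σ = 0` off the branch lines; decay from the bounds); and
likewise the spectator kernel `ρ(x₀) · (x₁+is)/Φ(x₁+is)` (`ρ = 1/√|P|` frozen at height `0`,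
`V₁ = ρ Re k`, `U₁ = −ρ Im k/(1−σ)²`, `B₁ = −ρ Im k′/(1−σ)²`, `k′ = (1 − (z/2)Σⱼ(z−eⱼ)⁻¹)/Φ(z)`)
over `A = J_L`, `D = J_L × (ℝ \ E)`, for each of the six gaps `J_L`.
[cite: KontsevichZagier2001, §1.2 rule (3)] -/
theorem stub_kernelCalculus :
    ∀ (e : Fin 5 → ℚ), StrictMono e →
    ∀ (Φ : ℂ → ℂ), (∀ z, Φ z = ∏ j : Fin 5, Complex.sqrt (z - ((e j : ℝ) : ℂ))) →
    ∀ (m : ℝ → ℝ), (∀ x, m x =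
        (1 + ∑ k : Fin 5, |x - (e k : ℝ)| ^ (-(3:ℝ) / 4)) * (1 + x ^ 2) ^ (-(5:ℝ) / 8)) →
    (Integrable m ∧
      IntegrableOn (fun s : ℝ => (1 + s ^ (-(3:ℝ) / 4)) * (1 + s ^ 2) ^ (-(5:ℝ) / 8)) (Ioi 0) ∧
      IntegrableOn (fun s : ℝ => (1 + s ^ (-(3:ℝ) / 4)) * (1 + s ^ 2) ^ (-(5:ℝ) / 4)) (Ioi 0) ∧
      ∃ C : ℝ, 0 < C ∧ ∀ (x s : ℝ), 0 ≤ s → (∀ j, x ≠ (e j : ℝ)) →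
        ‖(Φ ((x : ℂ) + (s : ℂ) * Complex.I))⁻¹‖ ≤ C * m x * (1 + s ^ 2) ^ (-(5:ℝ) / 8) ∧
        ‖((x : ℂ) + (s : ℂ) * Complex.I) / Φ ((x : ℂ) + (s : ℂ) * Complex.I)‖ ≤
          C * m x * (1 + s ^ 2) ^ (-(1:ℝ) / 8) ∧
        (0 < s →
          ‖(Φ ((x : ℂ) + (s : ℂ) * Complex.I))⁻¹ *
              ∑ j : Fin 5, ((x : ℂ) + (s : ℂ) * Complex.I - ((e j : ℝ) : ℂ))⁻¹‖ ≤
            C * m x * (1 + s ^ (-(3:ℝ) / 4)) * (1 + s ^ 2) ^ (-(9:ℝ) / 8) ∧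
          ‖(1 - ((x : ℂ) + (s : ℂ) * Complex.I) / 2 *
                ∑ j : Fin 5, ((x : ℂ) + (s : ℂ) * Complex.I - ((e j : ℝ) : ℂ))⁻¹) /
              Φ ((x : ℂ) + (s : ℂ) * Complex.I)‖ ≤
            C * m x * (1 + s ^ (-(3:ℝ) / 4)) * (1 + s ^ 2) ^ (-(5:ℝ) / 8))) →
    (∀ (K K' : ℝ → ℝ → ℝ → ℂ) (V U B : (Fin 3 → ℝ) → ℝ),
      (∀ x₀ x₁ s, K x₀ x₁ s = ((x₁ : ℂ) + (s : ℂ) * Complex.I) /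
        (Φ ((x₀ : ℂ) + (s : ℂ) * Complex.I) * Φ ((x₁ : ℂ) + (s : ℂ) * Complex.I))) →
      (∀ x₀ x₁ s, K' x₀ x₁ s =
        (1 - ((x₁ : ℂ) + (s : ℂ) * Complex.I) / 2 *
          ∑ j : Fin 5, (((x₀ : ℂ) + (s : ℂ) * Complex.I - ((e j : ℝ) : ℂ))⁻¹ +
            ((x₁ : ℂ) + (s : ℂ) * Complex.I - ((e j : ℝ) : ℂ))⁻¹)) /
        (Φ ((x₀ : ℂ) + (s : ℂ) * Complex.I) * Φ ((x₁ : ℂ) + (s : ℂ) * Complex.I))) →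
      (∀ w, V w = if w 2 < 1 then (K (w 1 - w 0) (w 1) (w 2 / (1 - w 2))).im else 0) →
      (∀ w, U w = 1 / (1 - w 2) ^ 2 * (K (w 1 - w 0) (w 1) (w 2 / (1 - w 2))).re) →
      (∀ w, B w = 1 / (1 - w 2) ^ 2 * (K' (w 1 - w 0) (w 1) (w 2 / (1 - w 2))).re) →
      IsSemialgebraic ℚ {t : Fin 1 → ℝ | t 0 ∈ Ioi (0:ℝ)} ∧
      IsSemialgebraic ℚ {y : Fin 2 → ℝ | 0 < y 0 ∧ ∀ j, y 1 ≠ (e j : ℝ) ∧ y 1 - y 0 ≠ (e j : ℝ)} ∧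
      {y : Fin 2 → ℝ | 0 < y 0 ∧ ∀ j, y 1 ≠ (e j : ℝ) ∧ y 1 - y 0 ≠ (e j : ℝ)} ⊆
        {y : Fin 2 → ℝ | y 0 ∈ Ioi (0:ℝ)} ∧
      volume ({y : Fin 2 → ℝ | y 0 ∈ Ioi (0:ℝ)} \
        {y : Fin 2 → ℝ | 0 < y 0 ∧ ∀ j, y 1 ≠ (e j : ℝ) ∧ y 1 - y 0 ≠ (e j : ℝ)}) = 0 ∧
      IsSemialgebraicFunOn ℚ
        {w : Fin 3 → ℝ | (![w 0, w 1] : Fin 2 → ℝ) ∈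
            {y : Fin 2 → ℝ | 0 < y 0 ∧ ∀ j, y 1 ≠ (e j : ℝ) ∧ y 1 - y 0 ≠ (e j : ℝ)} ∧
          0 ≤ w 2 ∧ w 2 ≤ 1} V ∧
      (∀ y ∈ {y : Fin 2 → ℝ | 0 < y 0 ∧ ∀ j, y 1 ≠ (e j : ℝ) ∧ y 1 - y 0 ≠ (e j : ℝ)},
        ContinuousOn (fun σ : ℝ => V ![y 0, y 1, σ]) (Icc 0 1) ∧ V ![y 0, y 1, 1] = 0 ∧
        ∀ σ ∈ Ioo (0:ℝ) 1, HasDerivAt (fun σ : ℝ => V ![y 0, y 1, σ]) (B ![y 0, y 1, σ]) σ) ∧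
      IsSemialgebraicFunOn ℚ {w : Fin 3 → ℝ | w 0 ∈ Ioi (0:ℝ) ∧ 0 < w 2 ∧ w 2 < 1} B ∧
      IsSemialgebraicFunOn ℚ {w : Fin 3 → ℝ | w 0 ∈ Ioi (0:ℝ) ∧ 0 < w 2 ∧ w 2 < 1} U ∧
      (∀ a ∈ Ioi (0:ℝ), ∀ σ ∈ Ioo (0:ℝ) 1,
        (∀ τ : ℝ, HasDerivAt (fun τ : ℝ => U ![a, τ, σ]) (B ![a, τ, σ]) τ) ∧
        Tendsto (fun τ : ℝ => U ![a, τ, σ]) atTop (𝓝 0) ∧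
        Tendsto (fun τ : ℝ => U ![a, τ, σ]) atBot (𝓝 0))) ∧
    (∀ (ρ : ℝ → ℝ) (k k' : ℝ → ℝ → ℂ) (V U B : (Fin 3 → ℝ) → ℝ),
      (∀ t, ρ t = 1 / Real.sqrt |∏ i : Fin 5, (t - (e i : ℝ))|) →
      (∀ x s, k x s = ((x : ℂ) + (s : ℂ) * Complex.I) / Φ ((x : ℂ) + (s : ℂ) * Complex.I)) →
      (∀ x s, k' x s = (1 - ((x : ℂ) + (s : ℂ) * Complex.I) / 2 *
          ∑ j : Fin 5, ((x : ℂ) + (s : ℂ) * Complex.I - ((e j : ℝ) : ℂ))⁻¹) /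
        Φ ((x : ℂ) + (s : ℂ) * Complex.I)) →
      (∀ w, V w = if w 2 < 1 then ρ (w 0) * (k (w 1) (w 2 / (1 - w 2))).re else 0) →
      (∀ w, U w = -(1 / (1 - w 2) ^ 2 * ρ (w 0) * (k (w 1) (w 2 / (1 - w 2))).im)) →
      (∀ w, B w = -(1 / (1 - w 2) ^ 2 * ρ (w 0) * (k' (w 1) (w 2 / (1 - w 2))).im)) →
      ∀ L : Fin 6,
      IsSemialgebraic ℚ {t : Fin 1 → ℝ | t 0 ∈
        (![Set.Iio (e 0 : ℝ), Set.Ioo (e 0 : ℝ) (e 1 : ℝ), Set.Ioo (e 1 : ℝ) (e 2 : ℝ),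
           Set.Ioo (e 2 : ℝ) (e 3 : ℝ), Set.Ioo (e 3 : ℝ) (e 4 : ℝ), Set.Ioi (e 4 : ℝ)] : Fin 6 → Set ℝ) L} ∧
      IsSemialgebraic ℚ {y : Fin 2 → ℝ | y 0 ∈
        (![Set.Iio (e 0 : ℝ), Set.Ioo (e 0 : ℝ) (e 1 : ℝ), Set.Ioo (e 1 : ℝ) (e 2 : ℝ),
           Set.Ioo (e 2 : ℝ) (e 3 : ℝ), Set.Ioo (e 3 : ℝ) (e 4 : ℝ), Set.Ioi (e 4 : ℝ)] : Fin 6 → Set ℝ) L ∧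
          ∀ j, y 1 ≠ (e j : ℝ)} ∧
      {y : Fin 2 → ℝ | y 0 ∈
        (![Set.Iio (e 0 : ℝ), Set.Ioo (e 0 : ℝ) (e 1 : ℝ), Set.Ioo (e 1 : ℝ) (e 2 : ℝ),
           Set.Ioo (e 2 : ℝ) (e 3 : ℝ), Set.Ioo (e 3 : ℝ) (e 4 : ℝ), Set.Ioi (e 4 : ℝ)] : Fin 6 → Set ℝ) L ∧
          ∀ j, y 1 ≠ (e j : ℝ)} ⊆
        {y : Fin 2 → ℝ | y 0 ∈
          (![Set.Iio (e 0 : ℝ), Set.Ioo (e 0 : ℝ) (e 1 : ℝ), Set.Ioo (e 1 : ℝ) (e 2 : ℝ),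
             Set.Ioo (e 2 : ℝ) (e 3 : ℝ), Set.Ioo (e 3 : ℝ) (e 4 : ℝ), Set.Ioi (e 4 : ℝ)] : Fin 6 → Set ℝ) L} ∧
      volume ({y : Fin 2 → ℝ | y 0 ∈
          (![Set.Iio (e 0 : ℝ), Set.Ioo (e 0 : ℝ) (e 1 : ℝ), Set.Ioo (e 1 : ℝ) (e 2 : ℝ),
             Set.Ioo (e 2 : ℝ) (e 3 : ℝ), Set.Ioo (e 3 : ℝ) (e 4 : ℝ), Set.Ioi (e 4 : ℝ)] : Fin 6 → Set ℝ) L} \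
        {y : Fin 2 → ℝ | y 0 ∈
          (![Set.Iio (e 0 : ℝ), Set.Ioo (e 0 : ℝ) (e 1 : ℝ), Set.Ioo (e 1 : ℝ) (e 2 : ℝ),
             Set.Ioo (e 2 : ℝ) (e 3 : ℝ), Set.Ioo (e 3 : ℝ) (e 4 : ℝ), Set.Ioi (e 4 : ℝ)] : Fin 6 → Set ℝ) L ∧
            ∀ j, y 1 ≠ (e j : ℝ)}) = 0 ∧
      IsSemialgebraicFunOn ℚ
        {w : Fin 3 → ℝ | (![w 0, w 1] : Fin 2 → ℝ) ∈
            {y : Fin 2 → ℝ | y 0 ∈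
              (![Set.Iio (e 0 : ℝ), Set.Ioo (e 0 : ℝ) (e 1 : ℝ), Set.Ioo (e 1 : ℝ) (e 2 : ℝ),
                 Set.Ioo (e 2 : ℝ) (e 3 : ℝ), Set.Ioo (e 3 : ℝ) (e 4 : ℝ), Set.Ioi (e 4 : ℝ)] : Fin 6 → Set ℝ) L ∧
                ∀ j, y 1 ≠ (e j : ℝ)} ∧
          0 ≤ w 2 ∧ w 2 ≤ 1} V ∧
      (∀ y ∈ {y : Fin 2 → ℝ | y 0 ∈
          (![Set.Iio (e 0 : ℝ), Set.Ioo (e 0 : ℝ) (e 1 : ℝ), Set.Ioo (e 1 : ℝ) (e 2 : ℝ),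
             Set.Ioo (e 2 : ℝ) (e 3 : ℝ), Set.Ioo (e 3 : ℝ) (e 4 : ℝ), Set.Ioi (e 4 : ℝ)] : Fin 6 → Set ℝ) L ∧
            ∀ j, y 1 ≠ (e j : ℝ)},
        ContinuousOn (fun σ : ℝ => V ![y 0, y 1, σ]) (Icc 0 1) ∧ V ![y 0, y 1, 1] = 0 ∧
        ∀ σ ∈ Ioo (0:ℝ) 1, HasDerivAt (fun σ : ℝ => V ![y 0, y 1, σ]) (B ![y 0, y 1, σ]) σ) ∧
      IsSemialgebraicFunOn ℚ {w : Fin 3 → ℝ | w 0 ∈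
          (![Set.Iio (e 0 : ℝ), Set.Ioo (e 0 : ℝ) (e 1 : ℝ), Set.Ioo (e 1 : ℝ) (e 2 : ℝ),
             Set.Ioo (e 2 : ℝ) (e 3 : ℝ), Set.Ioo (e 3 : ℝ) (e 4 : ℝ), Set.Ioi (e 4 : ℝ)] : Fin 6 → Set ℝ) L ∧
        0 < w 2 ∧ w 2 < 1} B ∧
      IsSemialgebraicFunOn ℚ {w : Fin 3 → ℝ | w 0 ∈
          (![Set.Iio (e 0 : ℝ), Set.Ioo (e 0 : ℝ) (e 1 : ℝ), Set.Ioo (e 1 : ℝ) (e 2 : ℝ),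
             Set.Ioo (e 2 : ℝ) (e 3 : ℝ), Set.Ioo (e 3 : ℝ) (e 4 : ℝ), Set.Ioi (e 4 : ℝ)] : Fin 6 → Set ℝ) L ∧
        0 < w 2 ∧ w 2 < 1} U ∧
      (∀ a ∈ (![Set.Iio (e 0 : ℝ), Set.Ioo (e 0 : ℝ) (e 1 : ℝ), Set.Ioo (e 1 : ℝ) (e 2 : ℝ),
             Set.Ioo (e 2 : ℝ) (e 3 : ℝ), Set.Ioo (e 3 : ℝ) (e 4 : ℝ), Set.Ioi (e 4 : ℝ)] : Fin 6 → Set ℝ) L,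
        ∀ σ ∈ Ioo (0:ℝ) 1,
        (∀ τ : ℝ, HasDerivAt (fun τ : ℝ => U ![a, τ, σ]) (B ![a, τ, σ]) τ) ∧
        Tendsto (fun τ : ℝ => U ![a, τ, σ]) atTop (𝓝 0) ∧
        Tendsto (fun τ : ℝ => U ![a, τ, σ]) atBot (𝓝 0))) := by
  sorry

/-! ## Stub 4 — absolute integrability of the two bulks on the open prisms -/

/-- **Kernel integrability.** The bulks `B = Re K′/(1−σ)²` (simplex kernel, prism
`{u > 0} × ℝ × (0,1)`) and `B₁ = −ρ(x₀) Im k′/(1−σ)²` (spectator kernel, prism `J_L × ℝ × (0,1)`) are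
absolutely integrable: after `s = σ/(1−σ)` (Jacobian `(1−σ)⁻²`) and the shear `(u,τ) ↦ (τ−u,τ)`
(Jacobian `1`) both are dominated, by `stub_bounds`, by a product `C m(x₀) m(x₁) ν(s)` of integrable
one-variable weights (Tonelli). [folklore] -/
theorem stub_kernelIntegrable :
    ∀ (e : Fin 5 → ℚ), StrictMono e →
    ∀ (Φ : ℂ → ℂ), (∀ z, Φ z = ∏ j : Fin 5, Complex.sqrt (z - ((e j : ℝ) : ℂ))) →
    ∀ (m : ℝ → ℝ), (∀ x, m x =
        (1 + ∑ k : Fin 5, |x - (e k : ℝ)| ^ (-(3:ℝ) / 4)) * (1 + x ^ 2) ^ (-(5:ℝ) / 8)) →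
    (Integrable m ∧
      IntegrableOn (fun s : ℝ => (1 + s ^ (-(3:ℝ) / 4)) * (1 + s ^ 2) ^ (-(5:ℝ) / 8)) (Ioi 0) ∧
      IntegrableOn (fun s : ℝ => (1 + s ^ (-(3:ℝ) / 4)) * (1 + s ^ 2) ^ (-(5:ℝ) / 4)) (Ioi 0) ∧
      ∃ C : ℝ, 0 < C ∧ ∀ (x s : ℝ), 0 ≤ s → (∀ j, x ≠ (e j : ℝ)) →
        ‖(Φ ((x : ℂ) + (s : ℂ) * Complex.I))⁻¹‖ ≤ C * m x * (1 + s ^ 2) ^ (-(5:ℝ) / 8) ∧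
        ‖((x : ℂ) + (s : ℂ) * Complex.I) / Φ ((x : ℂ) + (s : ℂ) * Complex.I)‖ ≤
          C * m x * (1 + s ^ 2) ^ (-(1:ℝ) / 8) ∧
        (0 < s →
          ‖(Φ ((x : ℂ) + (s : ℂ) * Complex.I))⁻¹ *
              ∑ j : Fin 5, ((x : ℂ) + (s : ℂ) * Complex.I - ((e j : ℝ) : ℂ))⁻¹‖ ≤
            C * m x * (1 + s ^ (-(3:ℝ) / 4)) * (1 + s ^ 2) ^ (-(9:ℝ) / 8) ∧
          ‖(1 - ((x : ℂ) + (s : ℂ) * Complex.I) / 2 *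
                ∑ j : Fin 5, ((x : ℂ) + (s : ℂ) * Complex.I - ((e j : ℝ) : ℂ))⁻¹) /
              Φ ((x : ℂ) + (s : ℂ) * Complex.I)‖ ≤
            C * m x * (1 + s ^ (-(3:ℝ) / 4)) * (1 + s ^ 2) ^ (-(5:ℝ) / 8))) →
    (∀ (K' : ℝ → ℝ → ℝ → ℂ) (B : (Fin 3 → ℝ) → ℝ),
      (∀ x₀ x₁ s, K' x₀ x₁ s =
        (1 - ((x₁ : ℂ) + (s : ℂ) * Complex.I) / 2 *
          ∑ j : Fin 5, (((x₀ : ℂ) + (s : ℂ) * Complex.I - ((e j : ℝ) : ℂ))⁻¹ +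
            ((x₁ : ℂ) + (s : ℂ) * Complex.I - ((e j : ℝ) : ℂ))⁻¹)) /
        (Φ ((x₀ : ℂ) + (s : ℂ) * Complex.I) * Φ ((x₁ : ℂ) + (s : ℂ) * Complex.I))) →
      (∀ w, B w = 1 / (1 - w 2) ^ 2 * (K' (w 1 - w 0) (w 1) (w 2 / (1 - w 2))).re) →
      IntegrableOn B {w : Fin 3 → ℝ | w 0 ∈ Ioi (0:ℝ) ∧ 0 < w 2 ∧ w 2 < 1}) ∧
    (∀ (ρ : ℝ → ℝ) (k' : ℝ → ℝ → ℂ) (B : (Fin 3 → ℝ) → ℝ),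
      (∀ t, ρ t = 1 / Real.sqrt |∏ i : Fin 5, (t - (e i : ℝ))|) →
      (∀ x s, k' x s = (1 - ((x : ℂ) + (s : ℂ) * Complex.I) / 2 *
          ∑ j : Fin 5, ((x : ℂ) + (s : ℂ) * Complex.I - ((e j : ℝ) : ℂ))⁻¹) /
        Φ ((x : ℂ) + (s : ℂ) * Complex.I)) →
      (∀ w, B w = -(1 / (1 - w 2) ^ 2 * ρ (w 0) * (k' (w 1) (w 2 / (1 - w 2))).im)) →
      ∀ L : Fin 6,
      IntegrableOn B {w : Fin 3 → ℝ | w 0 ∈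
          (![Set.Iio (e 0 : ℝ), Set.Ioo (e 0 : ℝ) (e 1 : ℝ), Set.Ioo (e 1 : ℝ) (e 2 : ℝ),
             Set.Ioo (e 2 : ℝ) (e 3 : ℝ), Set.Ioo (e 3 : ℝ) (e 4 : ℝ), Set.Ioi (e 4 : ℝ)] : Fin 6 → Set ℝ) L ∧
        0 < w 2 ∧ w 2 < 1}) := by
  sorry

/-! ## Stub 5 — the two bottom faces, cut along the gap grid (rules 1, 2; boundary phases) -/

/-- **Faces.** On the gap `J_k` (`k` roots to the left) `1/Φ(x) = εₖ/√|P(x)|` with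
`ε = (−i, 1, i, −1, −i, 1)` (`√(negative) = i √|·|`).  (I) Simplex face: the shear
`(u,τ) ↦ (x₀,x₁) = (τ−u, τ)` (rule 2, Jacobian 1) carries the base `{u>0, τ∉E, τ−u∉E}` with
integrand `Im K(τ−u,τ,0)` onto `{x₀<x₁} \ lines` with integrand `Im(x₁/(Φ(x₀)Φ(x₁)))`, which domain
additivity (rule 1) over the 15 boxes `Jⱼ×Jₖ` (`j<k`) and 6 triangles splits into the nine cross-type
boxes with signs `Im(εⱼεₖ)` — the same-type pieces carry the zero integrand — all pieces being
restrictions of ONE global representation `G₂ = [(ℝ\E)², x₁/√(|P(x₀)||P(x₁)|)]`. (II) Column face: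
`[J_L × (ℝ\E), ρ(x₀) Re(x₁/Φ(x₁))]` splits into `+[J_L×J₁] − [J_L×J₃] + [J_L×J₅]` (real phases) and
three zero pieces. [cite: KontsevichZagier2001, §1.2 rules (1), (2)] -/
theorem stub_faces :
    ∀ (e : Fin 5 → ℚ), StrictMono e →
    ∀ (Φ : ℂ → ℂ), (∀ z, Φ z = ∏ j : Fin 5, Complex.sqrt (z - ((e j : ℝ) : ℂ))) →
    ∀ (J : Fin 6 → Set ℝ), J = ![Set.Iio (e 0 : ℝ), Set.Ioo (e 0 : ℝ) (e 1 : ℝ),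
        Set.Ioo (e 1 : ℝ) (e 2 : ℝ), Set.Ioo (e 2 : ℝ) (e 3 : ℝ), Set.Ioo (e 3 : ℝ) (e 4 : ℝ),
        Set.Ioi (e 4 : ℝ)] →
    ∀ (f : (Fin 2 → ℝ) → ℝ), (∀ x, f x =
        x 1 / Real.sqrt (|∏ i : Fin 5, (x 0 - (e i : ℝ))| * |∏ i : Fin 5, (x 1 - (e i : ℝ))|)) →
    ∀ (G₂ : KZ.IntegralRep 2), G₂.domain = {x | ∀ j, x 0 ≠ (e j : ℝ) ∧ x 1 ≠ (e j : ℝ)} →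
      G₂.integrand = f →
    (∀ (p01 p03 p05 p12 p14 p23 p25 p34 p45 : KZ.IntegralRep 2),
      (p01.domain = {x | x 0 ∈ J 0 ∧ x 1 ∈ J 1} ∧ p01.integrand = f) →
      (p03.domain = {x | x 0 ∈ J 0 ∧ x 1 ∈ J 3} ∧ p03.integrand = f) →
      (p05.domain = {x | x 0 ∈ J 0 ∧ x 1 ∈ J 5} ∧ p05.integrand = f) →
      (p12.domain = {x | x 0 ∈ J 1 ∧ x 1 ∈ J 2} ∧ p12.integrand = f) →
      (p14.domain = {x | x 0 ∈ J 1 ∧ x 1 ∈ J 4} ∧ p14.integrand = f) →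
      (p23.domain = {x | x 0 ∈ J 2 ∧ x 1 ∈ J 3} ∧ p23.integrand = f) →
      (p25.domain = {x | x 0 ∈ J 2 ∧ x 1 ∈ J 5} ∧ p25.integrand = f) →
      (p34.domain = {x | x 0 ∈ J 3 ∧ x 1 ∈ J 4} ∧ p34.integrand = f) →
      (p45.domain = {x | x 0 ∈ J 4 ∧ x 1 ∈ J 5} ∧ p45.integrand = f) →
      ∃ F : KZ.IntegralRep 2,
        F.domain = {y : Fin 2 → ℝ | 0 < y 0 ∧ ∀ j, y 1 ≠ (e j : ℝ) ∧ y 1 - y 0 ≠ (e j : ℝ)} ∧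
        EqOn F.integrand
          (fun y => (((y 1 : ℝ) : ℂ) / (Φ ((y 1 - y 0 : ℝ) : ℂ) * Φ ((y 1 : ℝ) : ℂ))).im)
          {y : Fin 2 → ℝ | 0 < y 0 ∧ ∀ j, y 1 ≠ (e j : ℝ) ∧ y 1 - y 0 ≠ (e j : ℝ)} ∧
        KZ.of F - (-KZ.of p01 + KZ.of p03 - KZ.of p05 + KZ.of p12 - KZ.of p14 - KZ.of p23
          + KZ.of p25 + KZ.of p34 - KZ.of p45) ∈ KZ.relations) ∧
    (∀ (ρ : ℝ → ℝ), (∀ t, ρ t = 1 / Real.sqrt |∏ i : Fin 5, (t - (e i : ℝ))|) →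
      ∀ (L : Fin 6) (q1 q3 q5 : KZ.IntegralRep 2),
      (q1.domain = {x | x 0 ∈ J L ∧ x 1 ∈ J 1} ∧ q1.integrand = f) →
      (q3.domain = {x | x 0 ∈ J L ∧ x 1 ∈ J 3} ∧ q3.integrand = f) →
      (q5.domain = {x | x 0 ∈ J L ∧ x 1 ∈ J 5} ∧ q5.integrand = f) →
      ∃ Fc : KZ.IntegralRep 2,
        Fc.domain = {y : Fin 2 → ℝ | y 0 ∈ J L ∧ ∀ j, y 1 ≠ (e j : ℝ)} ∧
        EqOn Fc.integrand (fun y => ρ (y 0) * (((y 1 : ℝ) : ℂ) / Φ ((y 1 : ℝ) : ℂ)).re)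
          {y : Fin 2 → ℝ | y 0 ∈ J L ∧ ∀ j, y 1 ≠ (e j : ℝ)} ∧
        KZ.of Fc - (KZ.of q1 - KZ.of q3 + KZ.of q5) ∈ KZ.relations) := by
  sorry

/-! ## Stub 6 — box representations exist -/

/-- **Box representations.** The ordered product integrand `f(x₀,x₁) = x₁/√(|P(x₀)||P(x₁)|)` is
`ℚ`-semialgebraic off the branch lines and absolutely integrable on all of `ℝ²` (it is the product
`(1/√|P(x₀)|)·(x₁/√|P(x₁)|)` of two integrable functions of one variable: edge singularities
`|x−eⱼ|^{−1/2}`, decay `|x|^{−5/2}`, `|x|^{−3/2}`; dominated via `stub_bounds` at height `0`), so the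
global representation `[(ℝ\E)², f]` and every box `[Jⱼ×Jₖ, f]` exist. [folklore] -/
theorem stub_boxReps :
    ∀ (e : Fin 5 → ℚ), StrictMono e →
    ∀ (Φ : ℂ → ℂ), (∀ z, Φ z = ∏ j : Fin 5, Complex.sqrt (z - ((e j : ℝ) : ℂ))) →
    ∀ (m : ℝ → ℝ), (∀ x, m x =
        (1 + ∑ k : Fin 5, |x - (e k : ℝ)| ^ (-(3:ℝ) / 4)) * (1 + x ^ 2) ^ (-(5:ℝ) / 8)) →
    (Integrable m ∧
      IntegrableOn (fun s : ℝ => (1 + s ^ (-(3:ℝ) / 4)) * (1 + s ^ 2) ^ (-(5:ℝ) / 8)) (Ioi 0) ∧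
      IntegrableOn (fun s : ℝ => (1 + s ^ (-(3:ℝ) / 4)) * (1 + s ^ 2) ^ (-(5:ℝ) / 4)) (Ioi 0) ∧
      ∃ C : ℝ, 0 < C ∧ ∀ (x s : ℝ), 0 ≤ s → (∀ j, x ≠ (e j : ℝ)) →
        ‖(Φ ((x : ℂ) + (s : ℂ) * Complex.I))⁻¹‖ ≤ C * m x * (1 + s ^ 2) ^ (-(5:ℝ) / 8) ∧
        ‖((x : ℂ) + (s : ℂ) * Complex.I) / Φ ((x : ℂ) + (s : ℂ) * Complex.I)‖ ≤
          C * m x * (1 + s ^ 2) ^ (-(1:ℝ) / 8) ∧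
        (0 < s →
          ‖(Φ ((x : ℂ) + (s : ℂ) * Complex.I))⁻¹ *
              ∑ j : Fin 5, ((x : ℂ) + (s : ℂ) * Complex.I - ((e j : ℝ) : ℂ))⁻¹‖ ≤
            C * m x * (1 + s ^ (-(3:ℝ) / 4)) * (1 + s ^ 2) ^ (-(9:ℝ) / 8) ∧
          ‖(1 - ((x : ℂ) + (s : ℂ) * Complex.I) / 2 *
                ∑ j : Fin 5, ((x : ℂ) + (s : ℂ) * Complex.I - ((e j : ℝ) : ℂ))⁻¹) /
              Φ ((x : ℂ) + (s : ℂ) * Complex.I)‖ ≤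
            C * m x * (1 + s ^ (-(3:ℝ) / 4)) * (1 + s ^ 2) ^ (-(5:ℝ) / 8))) →
    ∀ (J : Fin 6 → Set ℝ), J = ![Set.Iio (e 0 : ℝ), Set.Ioo (e 0 : ℝ) (e 1 : ℝ),
        Set.Ioo (e 1 : ℝ) (e 2 : ℝ), Set.Ioo (e 2 : ℝ) (e 3 : ℝ), Set.Ioo (e 3 : ℝ) (e 4 : ℝ),
        Set.Ioi (e 4 : ℝ)] →
    ∀ (f : (Fin 2 → ℝ) → ℝ), (∀ x, f x =
        x 1 / Real.sqrt (|∏ i : Fin 5, (x 0 - (e i : ℝ))| * |∏ i : Fin 5, (x 1 - (e i : ℝ))|)) →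
    (∃ G₂ : KZ.IntegralRep 2,
        G₂.domain = {x | ∀ j, x 0 ≠ (e j : ℝ) ∧ x 1 ≠ (e j : ℝ)} ∧ G₂.integrand = f) ∧
    (∀ j k : Fin 6, ∃ p : KZ.IntegralRep 2,
        p.domain = {x | x 0 ∈ J j ∧ x 1 ∈ J k} ∧ p.integrand = f) := by
  sorry

/-! ## Stub 7 — antisymmetrisation glue (rules 1b, 2) -/

/-- **Swap glue.** On a box `(a,b) × (c,d)` the crux integrand
`g = (x₁ − x₀)/√(|P(x₀)||P(x₁)|)` is `f − f∘swap`, `f = x₁/√(|P(x₀)||P(x₁)|)` (rule 1b), and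
`[(a,b)×(c,d), f∘swap] ∼ [(c,d)×(a,b), f]` by the coordinate swap (rule 2, `|det| = 1`): so
`[r] − [p] + [p′] ∈ relations` for any representations `r` (crux box), `p` (ordered box) and `p′`
(transposed ordered box). [cite: KontsevichZagier2001, §1.2 rules (1), (2)] -/
theorem stub_swapGlue :
    ∀ (e : Fin 5 → ℚ) (a b c d : ℝ) (r p p' : KZ.IntegralRep 2),
      r.domain = {x | a < x 0 ∧ x 0 < b ∧ c < x 1 ∧ x 1 < d} →
      EqOn r.integrand (fun x => (x 1 - x 0) /
        Real.sqrt (|∏ i : Fin 5, (x 0 - (e i : ℝ))| * |∏ i : Fin 5, (x 1 - (e i : ℝ))|)) r.domain →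
      p.domain = {x | x 0 ∈ Ioo a b ∧ x 1 ∈ Ioo c d} →
      (p.integrand = fun x => x 1 /
        Real.sqrt (|∏ i : Fin 5, (x 0 - (e i : ℝ))| * |∏ i : Fin 5, (x 1 - (e i : ℝ))|)) →
      p'.domain = {x | x 0 ∈ Ioo c d ∧ x 1 ∈ Ioo a b} →
      (p'.integrand = fun x => x 1 /
        Real.sqrt (|∏ i : Fin 5, (x 0 - (e i : ℝ))| * |∏ i : Fin 5, (x 1 - (e i : ℝ))|)) →
      KZ.of r - KZ.of p + KZ.of p' ∈ KZ.relations := by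
  sorry

end Summit.KontsevichZagierPeriods.UnfoldedStokes.HyperellipticRiemannRelationLine

-- `Summit.<Summit>.<Sub>` with Sub = Summit (single-conjunct summit, D-0017) duplicates the segment.
set_option linter.dupNamespace false

namespace Summit.KontsevichZagierPeriods.KontsevichZagierPeriods.Theorems

open Set MeasureTheory Filter Topology
open Literature.NumberTheory.Transcendental
open Literature.ModelTheory.ExponentialFields (IsSemialgebraic)
open Summit.KontsevichZagierPeriods.UnfoldedStokes.HyperellipticRiemannRelationLine

set_option maxHeartbeats 800000 in
/-- **Riemann's bilinear relation for the genus-2 curve `y² = ∏_{i<5}(x − eᵢ)` in interval form**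
(crux `HyperellipticRiemannRelation`, stmt-KontsevichZagierPeriods-3522):
`[J₁×J₂, g] − [J₁×J₄, g] + [J₃×J₄, g] ∈ KZ.relations`.  Composition of the seven stubs: the crux
is `N′ + SL(0) − SL(2) + SL(4)` up to the antisymmetrisation glue, where the nine-term face `N′` and
the fibred linear relations `SL(L)` are the bottom faces of the two transport prisms.
[cite: KontsevichZagier2001, §1.2] -/
theorem HyperellipticRiemannRelation_of :
    Summit.KontsevichZagierPeriods.KontsevichZagierPeriods.Theses.UnfoldedStokes.HyperellipticRiemannRelation := by
  intro e he r12 r14 r34 h12d h14d h34d h12i h14i h34i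
  -- the written-out objects
  set Φ : ℂ → ℂ := fun z => ∏ j : Fin 5, Complex.sqrt (z - ((e j : ℝ) : ℂ)) with hΦdef
  have hΦ : ∀ z, Φ z = ∏ j : Fin 5, Complex.sqrt (z - ((e j : ℝ) : ℂ)) := fun z => rfl
  set m : ℝ → ℝ := fun x =>
    (1 + ∑ k : Fin 5, |x - (e k : ℝ)| ^ (-(3:ℝ) / 4)) * (1 + x ^ 2) ^ (-(5:ℝ) / 8) with hmdef
  have hm : ∀ x, m x =
      (1 + ∑ k : Fin 5, |x - (e k : ℝ)| ^ (-(3:ℝ) / 4)) * (1 + x ^ 2) ^ (-(5:ℝ) / 8) :=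
    fun x => rfl
  set J : Fin 6 → Set ℝ := ![Set.Iio (e 0 : ℝ), Set.Ioo (e 0 : ℝ) (e 1 : ℝ),
      Set.Ioo (e 1 : ℝ) (e 2 : ℝ), Set.Ioo (e 2 : ℝ) (e 3 : ℝ), Set.Ioo (e 3 : ℝ) (e 4 : ℝ),
      Set.Ioi (e 4 : ℝ)] with hJ
  set f : (Fin 2 → ℝ) → ℝ := fun x =>
    x 1 / Real.sqrt (|∏ i : Fin 5, (x 0 - (e i : ℝ))| * |∏ i : Fin 5, (x 1 - (e i : ℝ))|) with hfdef
  have hf : ∀ x, f x =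
      x 1 / Real.sqrt (|∏ i : Fin 5, (x 0 - (e i : ℝ))| * |∏ i : Fin 5, (x 1 - (e i : ℝ))|) :=
    fun x => rfl
  set ρ : ℝ → ℝ := fun t => 1 / Real.sqrt |∏ i : Fin 5, (t - (e i : ℝ))| with hρdef
  have hρ : ∀ t, ρ t = 1 / Real.sqrt |∏ i : Fin 5, (t - (e i : ℝ))| := fun t => rfl
  -- shared analysis
  have hbounds := stub_bounds e he Φ hΦ m hm
  obtain ⟨hcalc0, hcalc1⟩ := stub_kernelCalculus e he Φ hΦ m hm hbounds
  obtain ⟨hint0, hint1⟩ := stub_kernelIntegrable e he Φ hΦ m hm hbounds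
  obtain ⟨⟨G₂, hG₂d, hG₂i⟩, hbox⟩ := stub_boxReps e he Φ hΦ m hm hbounds J hJ f hf
  obtain ⟨hfaceS, hfaceC⟩ := stub_faces e he Φ hΦ J hJ f hf G₂ hG₂d hG₂i
  -- the twelve boxes
  obtain ⟨p01, h01⟩ := hbox 0 1
  obtain ⟨p03, h03⟩ := hbox 0 3
  obtain ⟨p05, h05⟩ := hbox 0 5
  obtain ⟨p12, h12⟩ := hbox 1 2
  obtain ⟨p14, h14⟩ := hbox 1 4
  obtain ⟨p21, h21⟩ := hbox 2 1
  obtain ⟨p23, h23⟩ := hbox 2 3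
  obtain ⟨p25, h25⟩ := hbox 2 5
  obtain ⟨p34, h34⟩ := hbox 3 4
  obtain ⟨p41, h41⟩ := hbox 4 1
  obtain ⟨p43, h43⟩ := hbox 4 3
  obtain ⟨p45, h45⟩ := hbox 4 5
  -- antisymmetrisation glue on the three crux boxes
  have hJ1 : J 1 = Set.Ioo (e 0 : ℝ) (e 1 : ℝ) := by rw [hJ]; rfl
  have hJ2 : J 2 = Set.Ioo (e 1 : ℝ) (e 2 : ℝ) := by rw [hJ]; rfl
  have hJ3 : J 3 = Set.Ioo (e 2 : ℝ) (e 3 : ℝ) := by rw [hJ]; rfl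
  have hJ4 : J 4 = Set.Ioo (e 3 : ℝ) (e 4 : ℝ) := by rw [hJ]; rfl
  have g12 : KZ.of r12 - KZ.of p12 + KZ.of p21 ∈ KZ.relations :=
    stub_swapGlue e (e 0) (e 1) (e 1) (e 2) r12 p12 p21 h12d h12i
      (by rw [h12.1, hJ1, hJ2]) h12.2 (by rw [h21.1, hJ1, hJ2]) h21.2
  have g14 : KZ.of r14 - KZ.of p14 + KZ.of p41 ∈ KZ.relations :=
    stub_swapGlue e (e 0) (e 1) (e 3) (e 4) r14 p14 p41 h14d h14i
      (by rw [h14.1, hJ1, hJ4]) h14.2 (by rw [h41.1, hJ1, hJ4]) h41.2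
  have g34 : KZ.of r34 - KZ.of p34 + KZ.of p43 ∈ KZ.relations :=
    stub_swapGlue e (e 2) (e 3) (e 3) (e 4) r34 p34 p43 h34d h34i
      (by rw [h34.1, hJ3, hJ4]) h34.2 (by rw [h43.1, hJ3, hJ4]) h43.2
  -- the simplex kernel and the nine-term identity
  set K : ℝ → ℝ → ℝ → ℂ := fun x₀ x₁ s => ((x₁ : ℂ) + (s : ℂ) * Complex.I) /
    (Φ ((x₀ : ℂ) + (s : ℂ) * Complex.I) * Φ ((x₁ : ℂ) + (s : ℂ) * Complex.I)) with hKdef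
  set K' : ℝ → ℝ → ℝ → ℂ := fun x₀ x₁ s =>
    (1 - ((x₁ : ℂ) + (s : ℂ) * Complex.I) / 2 *
      ∑ j : Fin 5, (((x₀ : ℂ) + (s : ℂ) * Complex.I - ((e j : ℝ) : ℂ))⁻¹ +
        ((x₁ : ℂ) + (s : ℂ) * Complex.I - ((e j : ℝ) : ℂ))⁻¹)) /
    (Φ ((x₀ : ℂ) + (s : ℂ) * Complex.I) * Φ ((x₁ : ℂ) + (s : ℂ) * Complex.I)) with hK'def
  set V : (Fin 3 → ℝ) → ℝ := fun w =>
    if w 2 < 1 then (K (w 1 - w 0) (w 1) (w 2 / (1 - w 2))).im else 0 with hVdef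
  set U : (Fin 3 → ℝ) → ℝ := fun w =>
    1 / (1 - w 2) ^ 2 * (K (w 1 - w 0) (w 1) (w 2 / (1 - w 2))).re with hUdef
  set B : (Fin 3 → ℝ) → ℝ := fun w =>
    1 / (1 - w 2) ^ 2 * (K' (w 1 - w 0) (w 1) (w 2 / (1 - w 2))).re with hBdef
  obtain ⟨hE1, hE2a, hE2b, hE2c, hE3, hE4, hE5B, hE5U, hE6⟩ :=
    hcalc0 K K' V U B (fun _ _ _ => rfl) (fun _ _ _ => rfl) (fun _ => rfl) (fun _ => rfl)
      (fun _ => rfl)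
  have hE5i := hint0 K' B (fun _ _ _ => rfl) (fun _ => rfl)
  obtain ⟨F, hFd, hFi, hFrel⟩ := hfaceS p01 p03 p05 p12 p14 p23 p25 p34 p45
    h01 h03 h05 h12 h14 h23 h25 h34 h45
  have hF : KZ.of F ∈ KZ.relations := by
    refine stub_engine (Ioi (0:ℝ))
      {y : Fin 2 → ℝ | 0 < y 0 ∧ ∀ j, y 1 ≠ (e j : ℝ) ∧ y 1 - y 0 ≠ (e j : ℝ)} V U B
      hE1 hE2a hE2b hE2c hE3 hE4 hE5B hE5U hE5i hE6 F hFd ?_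
    intro y hy
    rw [hFi hy]
    simp [hVdef, hKdef]
  have hN : -KZ.of p01 + KZ.of p03 - KZ.of p05 + KZ.of p12 - KZ.of p14 - KZ.of p23
      + KZ.of p25 + KZ.of p34 - KZ.of p45 ∈ KZ.relations := by
    have := KZ.relations.sub_mem hF hFrel
    simpa using this
  -- the spectator kernel and the three fibred linear relations
  set k : ℝ → ℝ → ℂ := fun x s =>
    ((x : ℂ) + (s : ℂ) * Complex.I) / Φ ((x : ℂ) + (s : ℂ) * Complex.I) with hkdef
  set k' : ℝ → ℝ → ℂ := fun x s =>
    (1 - ((x : ℂ) + (s : ℂ) * Complex.I) / 2 *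
      ∑ j : Fin 5, ((x : ℂ) + (s : ℂ) * Complex.I - ((e j : ℝ) : ℂ))⁻¹) /
    Φ ((x : ℂ) + (s : ℂ) * Complex.I) with hk'def
  set V₁ : (Fin 3 → ℝ) → ℝ := fun w =>
    if w 2 < 1 then ρ (w 0) * (k (w 1) (w 2 / (1 - w 2))).re else 0 with hV₁def
  set U₁ : (Fin 3 → ℝ) → ℝ := fun w =>
    -(1 / (1 - w 2) ^ 2 * ρ (w 0) * (k (w 1) (w 2 / (1 - w 2))).im) with hU₁def
  set B₁ : (Fin 3 → ℝ) → ℝ := fun w =>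
    -(1 / (1 - w 2) ^ 2 * ρ (w 0) * (k' (w 1) (w 2 / (1 - w 2))).im) with hB₁def
  have hcalcL := hcalc1 ρ k k' V₁ U₁ B₁ hρ (fun _ _ => rfl) (fun _ _ => rfl) (fun _ => rfl)
    (fun _ => rfl) (fun _ => rfl)
  have hintL := hint1 ρ k' B₁ hρ (fun _ _ => rfl) (fun _ => rfl)
  have hSL : ∀ (L : Fin 6) (q1 q3 q5 : KZ.IntegralRep 2),
      (q1.domain = {x | x 0 ∈ J L ∧ x 1 ∈ J 1} ∧ q1.integrand = f) →
      (q3.domain = {x | x 0 ∈ J L ∧ x 1 ∈ J 3} ∧ q3.integrand = f) →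
      (q5.domain = {x | x 0 ∈ J L ∧ x 1 ∈ J 5} ∧ q5.integrand = f) →
      KZ.of q1 - KZ.of q3 + KZ.of q5 ∈ KZ.relations := by
    intro L q1 q3 q5 hq1 hq3 hq5
    obtain ⟨Fc, hFcd, hFci, hFcrel⟩ := hfaceC ρ hρ L q1 q3 q5 hq1 hq3 hq5
    obtain ⟨hL1, hL2a, hL2b, hL2c, hL3, hL4, hL5B, hL5U, hL6⟩ := hcalcL L
    have hFc : KZ.of Fc ∈ KZ.relations := by
      refine stub_engine (J L) {y : Fin 2 → ℝ | y 0 ∈ J L ∧ ∀ j, y 1 ≠ (e j : ℝ)} V₁ U₁ B₁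
        (by simpa only [hJ] using hL1) (by simpa only [hJ] using hL2a)
        (by simpa only [hJ] using hL2b) (by simpa only [hJ] using hL2c)
        (by simpa only [hJ] using hL3) (by simpa only [hJ] using hL4)
        (by simpa only [hJ] using hL5B) (by simpa only [hJ] using hL5U)
        (by simpa only [hJ] using hintL L) (by simpa only [hJ] using hL6) Fc hFcd ?_
      intro y hy
      rw [hFci hy]
      simp [hV₁def, hkdef]
    have := KZ.relations.sub_mem hFc hFcrel
    simpa using this
  have hSL0 := hSL 0 p01 p03 p05 h01 h03 h05
  have hSL2 := hSL 2 p21 p23 p25 h21 h23 h25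
  have hSL4 := hSL 4 p41 p43 p45 h41 h43 h45
  -- free-abelian-group bookkeeping
  have key : KZ.of r12 - KZ.of r14 + KZ.of r34 =
      (KZ.of r12 - KZ.of p12 + KZ.of p21) - (KZ.of r14 - KZ.of p14 + KZ.of p41)
        + (KZ.of r34 - KZ.of p34 + KZ.of p43)
        + (-KZ.of p01 + KZ.of p03 - KZ.of p05 + KZ.of p12 - KZ.of p14 - KZ.of p23
            + KZ.of p25 + KZ.of p34 - KZ.of p45)
        + (KZ.of p01 - KZ.of p03 + KZ.of p05)
        - (KZ.of p21 - KZ.of p23 + KZ.of p25)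
        + (KZ.of p41 - KZ.of p43 + KZ.of p45) := by
    abel
  rw [key]
  refine KZ.relations.add_mem (KZ.relations.sub_mem (KZ.relations.add_mem
    (KZ.relations.add_mem (KZ.relations.add_mem (KZ.relations.sub_mem g12 g14) g34) hN) hSL0)
    hSL2) hSL4

end Summit.KontsevichZagierPeriods.KontsevichZagierPeriods.Theorems
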